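import Summits.MatrixMultiplication.MatrixMultiplication.Theorems.SaturationLadderTwinDefect
import HarnessLib

/-!
# SaturationLadder — the two atoms of the additive far-edge class and its dual certificate

Route `SaturationLadder` (sub-problem `MatrixMultiplication`), crux `SubexpSaturation`
(stmt-MatrixMultiplication-25909).  The twin pipeline (`SaturationLadderTwinEndpoint`,
`SaturationLadderTwinClassNoBase`, `…HullCeiling`, `…CwFamilyCeiling`) shows that the padded STAGE-2 twin
class proves `Base θ` exactly for `θ³ ≥ 3125/128`.  The cell's far-edge law (★) (decomp-mm lens-1,
gen9/far-edge-calculus-g9.txt; gen16/star-atoms-g16.txt) reduces EVERY additive rotation-mixed level-1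
z-perfect design on single-macro-block graded supports to a finite mixture of two kinds of factors:
a one-step factor (unit ⊕ V ⊕ socle of relative dimension `S ≥ 0`; A-mass `a`, B-mass `b ≤ S` on the
socle, the remaining socle mass `S − b` carried by unit patterns; `S = 0` is the null algebra, `S = 1`
is `CW_q`, `S = 2` the twin) contributing `(1+a) log(1+a) + (S−b) log((S−b)/S)` to the onset functional,
`a` to the A-mass, `b` to the B-mass and `1 + (S − b)` to the unit-pattern mass; and a rotated-null DONOR
(parameter `s ∈ [0,1]`) contributing `(1−s) log(1−s)`, B-mass `s`, unit mass `1 − s`.  The onset constant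
of the design is `c = (functional)/(A-mass)` subject to BALANCE (A-mass = B-mass) and the X-CONSTRAINT
(unit-pattern mass ≤ A-mass).  This file is the analytic half of that statement, kernel-checked:

* §1 the two ATOMS — tangent inequalities for `x log x` at `1 + a₀` and at `1 − s₀` — for any dual
  parameters `(s₀, a₀)` with the coupling condition `(C)  −s₀ − log(1−s₀) ≤ a₀ − log(1+a₀)`;
* §2 WEAK DUALITY: every finite mixture as above has `c ≥ 2 log(1+a₀) − a₀ + s₀` (`class_bound`); the
  one-factor corollaries are the one-step family over REAL socle dimension `S` (`oneStep_bound`, the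
  cell's "virtual socle" curve, minimal at `S⋆ = 2.0805`, integer values `log 4, c₂, log 3, …`) and the
  null-mix family (`nullMix_bound`, the g9 curve `F(s)`);
* §3 a rational certificate `(s₀, a₀) = (37/50, 77/50)` satisfying `(C)` (`certC`, via
  `exp(57/25) ≥ 127/13`) and the resulting kernel floor `1.0642 ≤ 2 log(127/50) − 4/5` (`floor_gt`);
  the supremum over admissible `(s₀, a₀)` is the cell's universal constant `c⋆ = 1.0645958…`
  (`θ⋆ = e^{c⋆} = 2.89967 < θ_c = (3125/128)^{1/3} = 2.90099`), attained in the limit `S → S⋆` /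
  by the null mix; the twin's `c₂ = log θ_c` is the integer point `S = 2` (`SaturationLadderTwinDefect.core`).

Scope (honest): the reduction of an actual `omegaRect` certificate to these quantities is kernel-certified
only for the twin class (the files above); for the other supports it is the cell's model (★).  No
definitions, no named facts, no sorry.
-/

set_option linter.dupNamespace false
-- (single-conjunct summit: the namespace repeats `MatrixMultiplication`)

noncomputable section

namespace Summit.MatrixMultiplication.MatrixMultiplication.Theorems.SaturationLadderClassAtoms

open Finset
open Summit.MatrixMultiplication.MatrixMultiplication.Theorems.SaturationLadderTwinDefect
  (mul_log_tangent)

/-! ### §1  The two atoms -/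

/-- **Atom A** (an A-letter of mass `a` whose rare `y` sits on the unit block already carrying the
forced unit pattern): tangent of `x log x` at `1 + a₀`,
`(log(1+a₀) + 1)·a − (a₀ − log(1+a₀)) ≤ (1+a) log(1+a)` for `a₀, a ≥ 0`. [folklore] -/
theorem atomA {a₀ a : ℝ} (ha₀ : 0 ≤ a₀) (ha : 0 ≤ a) :
    (Real.log (1 + a₀) + 1) * a - (a₀ - Real.log (1 + a₀)) ≤ (1 + a) * Real.log (1 + a) := by
  have t := mul_log_tangent (show (0 : ℝ) < 1 + a₀ by linarith) (show (0 : ℝ) ≤ 1 + a by linarith)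
  linarith

/-- **Atom D** (a dimension-one slice of a rare block fed by B-mass `σ` and unit patterns `1 − σ`):
for `s₀ < 1`, any `ξ` with `(C)  −s₀ − log(1−s₀) ≤ ξ`, and `σ ≤ 1` (`σ ≥ 0` is not needed),
`−ξ(1−σ) − (1−s₀)σ ≤ (1−σ) log(1−σ)` — tangent of `x log x` at `1 − s₀` plus `(C)`; equality at
`σ = s₀` when `(C)` is tight. [folklore] -/
theorem atomD {s₀ ξ σ : ℝ} (hs₀ : s₀ < 1) (hC : -s₀ - Real.log (1 - s₀) ≤ ξ) (hσ1 : σ ≤ 1) :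
    -(ξ * (1 - σ)) - (1 - s₀) * σ ≤ (1 - σ) * Real.log (1 - σ) := by
  have t := mul_log_tangent (show (0 : ℝ) < 1 - s₀ by linarith) (show (0 : ℝ) ≤ 1 - σ by linarith)
  have hM : 0 ≤ Real.log (1 - s₀) + s₀ + ξ := by linarith
  nlinarith [mul_nonneg (sub_nonneg.2 hσ1) hM]

/-- **Atom D, homogeneous form** (a socle of relative dimension `S ≥ 0` carrying B-mass `b ∈ [0, S]`
and unit patterns `S − b` is `S` donors at `σ = b/S`):
`−ξ(S−b) − (1−s₀) b ≤ (S−b) log((S−b)/S)`. [folklore] -/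
theorem atomD_hom {s₀ ξ S b : ℝ} (hs₀ : s₀ < 1) (hC : -s₀ - Real.log (1 - s₀) ≤ ξ)
    (hS : 0 ≤ S) (hb0 : 0 ≤ b) (hbS : b ≤ S) :
    -(ξ * (S - b)) - (1 - s₀) * b ≤ (S - b) * Real.log ((S - b) / S) := by
  rcases hS.eq_or_lt with h | h
  · have hb : b = 0 := le_antisymm (h ▸ hbS) hb0
    subst hb
    rw [← h]
    simp
  · have h1 := atomD (σ := b / S) hs₀ hC (div_le_one_of_le₀ hbS h.le)
    have e1 : 1 - b / S = (S - b) / S := by field_simp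
    rw [e1] at h1
    have h2 := mul_le_mul_of_nonneg_left h1 h.le
    have e3 : S * (-(ξ * ((S - b) / S)) - (1 - s₀) * (b / S)) = -(ξ * (S - b)) - (1 - s₀) * b := by
      field_simp
    have e4 : S * ((S - b) / S * Real.log ((S - b) / S)) = (S - b) * Real.log ((S - b) / S) := by
      field_simp
    rw [e3, e4] at h2
    exact h2

/-- The socle identity behind `atomD_hom` (informational): for `S > 0`, `b ≤ S`,
`(S−b) log(S−b) − S log S + b log S = (S−b) log((S−b)/S)` — the unit patterns' entropy defect, the
socle's dimension term and the B-letters' format penalty `b log S` combine into `S` copies of the donor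
defect `(1−σ) log(1−σ)`, `σ = b/S`. [folklore] -/
theorem socle_split {S b : ℝ} (hS : 0 < S) (hbS : b ≤ S) :
    (S - b) * Real.log (S - b) - S * Real.log S + b * Real.log S
      = (S - b) * Real.log ((S - b) / S) := by
  rcases hbS.eq_or_lt with h | h
  · subst h; simp
  · rw [Real.log_div (by linarith) hS.ne']
    ring

/-- **One-step factor, dual form** (`R_std ≥ 0`): for a one-step factor with socle `S ≥ 0`, A-mass
`a ≥ 0`, B-mass `b ∈ [0, S]`:
`(log(1+a₀)+1)·a − ξ·(1 + (S − b)) − (1 − s₀)·b ≤ (1+a) log(1+a) + (S−b) log((S−b)/S)`,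
`ξ = a₀ − log(1+a₀)`, under `(C)`. [folklore] -/
theorem factor_std {s₀ a₀ S a b : ℝ} (hs₀ : s₀ < 1) (ha₀ : 0 ≤ a₀)
    (hC : -s₀ - Real.log (1 - s₀) ≤ a₀ - Real.log (1 + a₀))
    (hS : 0 ≤ S) (ha : 0 ≤ a) (hb0 : 0 ≤ b) (hbS : b ≤ S) :
    (Real.log (1 + a₀) + 1) * a - (a₀ - Real.log (1 + a₀)) * (1 + (S - b)) - (1 - s₀) * b
      ≤ (1 + a) * Real.log (1 + a) + (S - b) * Real.log ((S - b) / S) := by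
  have hA := atomA ha₀ ha
  have hD := atomD_hom (ξ := a₀ - Real.log (1 + a₀)) hs₀ hC hS hb0 hbS
  linarith

/-! ### §2  Weak duality: the class bound and its one-factor corollaries -/

/-- **Class bound (weak duality).**  Dual parameters `s₀ < 1`, `a₀ ≥ 0` with `(C)`.  A finite mixture of
one-step factors `i ∈ t` (weights `w i ≥ 0`, socle `S i ≥ 0`, A-mass `a i ≥ 0`, B-mass
`0 ≤ b i ≤ S i`) and donors `k ∈ u` (weights `v k ≥ 0`, `s k ≤ 1`) satisfying BALANCE
`Σ w a = Σ w b + Σ v s` and the X-CONSTRAINT `Σ w (1 + (S − b)) + Σ v (1 − s) ≤ Σ w a` has onset functional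
at least `(2 log(1+a₀) − a₀ + s₀) · Σ w a`.  (For a design in the class the (★) onset functional is at
least the right side, factor by factor: z-full B-letters pay at least `log S`, extra unit patterns and
rare tails only add — gen16/star-atoms-g16.txt §3.)
[cite: CoppersmithWinograd1990, §8] [cite: AlmanDuanVassilevskaWilliamsXuXuZhou2025, §3.4] -/
theorem class_bound {s₀ a₀ : ℝ} (hs₀ : s₀ < 1) (ha₀ : 0 ≤ a₀)
    (hC : -s₀ - Real.log (1 - s₀) ≤ a₀ - Real.log (1 + a₀))
    {ι κ : Type*} (t : Finset ι) (u : Finset κ) (w a S b : ι → ℝ) (v s : κ → ℝ)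
    (hw : ∀ i ∈ t, 0 ≤ w i) (ha : ∀ i ∈ t, 0 ≤ a i) (hS : ∀ i ∈ t, 0 ≤ S i)
    (hb0 : ∀ i ∈ t, 0 ≤ b i) (hbS : ∀ i ∈ t, b i ≤ S i)
    (hv : ∀ k ∈ u, 0 ≤ v k) (hs1 : ∀ k ∈ u, s k ≤ 1)
    (hbal : ∑ i ∈ t, w i * a i = ∑ i ∈ t, w i * b i + ∑ k ∈ u, v k * s k)
    (hX : ∑ i ∈ t, w i * (1 + (S i - b i)) + ∑ k ∈ u, v k * (1 - s k) ≤ ∑ i ∈ t, w i * a i) :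
    (2 * Real.log (1 + a₀) - a₀ + s₀) * ∑ i ∈ t, w i * a i ≤
      ∑ i ∈ t, w i * ((1 + a i) * Real.log (1 + a i) + (S i - b i) * Real.log ((S i - b i) / S i))
        + ∑ k ∈ u, v k * ((1 - s k) * Real.log (1 - s k)) := by
  set κ₁ := Real.log (1 + a₀) + 1 with hκ₁
  set ξ := a₀ - Real.log (1 + a₀) with hξ
  set ν := 1 - s₀ with hν
  have hξ0 : 0 ≤ ξ := by
    have := Real.log_le_sub_one_of_pos (show (0 : ℝ) < 1 + a₀ by linarith)
    simp only [hξ]; linarith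
  -- factor-by-factor lower bounds, summed
  have h1 : ∑ i ∈ t, (κ₁ * (w i * a i) - ξ * (w i * (1 + (S i - b i))) - ν * (w i * b i)) ≤
      ∑ i ∈ t, w i * ((1 + a i) * Real.log (1 + a i) + (S i - b i) * Real.log ((S i - b i) / S i)) := by
    apply Finset.sum_le_sum
    intro i hi
    have hf := factor_std hs₀ ha₀ hC (hS i hi) (ha i hi) (hb0 i hi) (hbS i hi)
    have := mul_le_mul_of_nonneg_left hf (hw i hi)
    nlinarith [this]
  have h2 : ∑ k ∈ u, (-(ξ * (v k * (1 - s k))) - ν * (v k * s k)) ≤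
      ∑ k ∈ u, v k * ((1 - s k) * Real.log (1 - s k)) := by
    apply Finset.sum_le_sum
    intro k hk
    have hd := atomD (ξ := ξ) hs₀ hC (hs1 k hk)
    have := mul_le_mul_of_nonneg_left hd (hv k hk)
    nlinarith [this]
  rw [Finset.sum_sub_distrib, Finset.sum_sub_distrib, ← Finset.mul_sum, ← Finset.mul_sum,
    ← Finset.mul_sum] at h1
  rw [Finset.sum_sub_distrib, Finset.sum_neg_distrib, ← Finset.mul_sum, ← Finset.mul_sum] at h2
  have h3 := mul_le_mul_of_nonneg_left hX hξ0
  have e : 2 * Real.log (1 + a₀) - a₀ + s₀ = κ₁ - ξ - ν := by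
    simp only [hκ₁, hξ, hν]; ring
  rw [e]
  nlinarith [h1, h2, h3, hbal]

/-- **One-step family over real socle dimension** (the "virtual socle" curve; one factor, no donor,
X-constraint `1 + S − m ≤ m`): for `S ≥ 0`, `(S+1)/2 ≤ m ≤ S`,
`(2 log(1+a₀) − a₀ + s₀) · m ≤ (1+m) log(1+m) + (S−m) log((S−m)/S)`.  At `(s₀, a₀) → (s⋆, a⋆)` the left
constant tends to `c⋆ = 1.0645958…`, the infimum of the right side over `(S, m)` (attained at
`S⋆ = 2.0805`, `m = (S⋆+1)/2 = a⋆`); the integer points are `S = 1: log 4` (`CW_q`), `S = 2: c₂ = log θ_c`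
(twin, `SaturationLadderTwinDefect.core`), `S = 3: log 3`, … . [folklore] -/
theorem oneStep_bound {s₀ a₀ S m : ℝ} (hs₀ : s₀ < 1) (ha₀ : 0 ≤ a₀)
    (hC : -s₀ - Real.log (1 - s₀) ≤ a₀ - Real.log (1 + a₀))
    (hS : 0 ≤ S) (hm1 : (S + 1) / 2 ≤ m) (hm2 : m ≤ S) :
    (2 * Real.log (1 + a₀) - a₀ + s₀) * m ≤
      (1 + m) * Real.log (1 + m) + (S - m) * Real.log ((S - m) / S) := by
  have hm0 : 0 ≤ m := by linarith
  have hf := factor_std hs₀ ha₀ hC hS hm0 hm0 hm2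
  have hξ0 : 0 ≤ a₀ - Real.log (1 + a₀) := by
    have := Real.log_le_sub_one_of_pos (show (0 : ℝ) < 1 + a₀ by linarith)
    linarith
  nlinarith [mul_le_mul_of_nonneg_left (show 1 + (S - m) ≤ m by linarith) hξ0]

/-- **Null-mix family** (`N_q ⊗ N_q^σ`, g9: one null factor in standard orientation with A-mass
`a = s/(2s−1)` and `μ = 1/(2s−1)` rotated donors at parameter `s`, balance and X both tight):
for `1/2 < s < 1`, `(2 log(1+a₀) − a₀ + s₀) · a ≤ (1+a) log(1+a) + μ (1−s) log(1−s)`; the right side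
divided by `a` is the g9 curve `F(s)`, minimal (`= c⋆`) at `s⋆ = 0.74032`. [folklore] -/
theorem nullMix_bound {s₀ a₀ s : ℝ} (hs₀ : s₀ < 1) (ha₀ : 0 ≤ a₀)
    (hC : -s₀ - Real.log (1 - s₀) ≤ a₀ - Real.log (1 + a₀))
    (hs1 : 1 / 2 < s) (hs2 : s < 1) :
    (2 * Real.log (1 + a₀) - a₀ + s₀) * (s / (2 * s - 1)) ≤
      (1 + s / (2 * s - 1)) * Real.log (1 + s / (2 * s - 1))
        + 1 / (2 * s - 1) * ((1 - s) * Real.log (1 - s)) := by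
  have hd : 0 < 2 * s - 1 := by linarith
  have ha : 0 ≤ s / (2 * s - 1) := div_nonneg (by linarith) hd.le
  have hμ : 0 ≤ 1 / (2 * s - 1) := div_nonneg zero_le_one hd.le
  have hA := atomA ha₀ ha
  have hD := atomD (ξ := a₀ - Real.log (1 + a₀)) hs₀ hC hs2.le
  have hD' := mul_le_mul_of_nonneg_left hD hμ
  -- balance `a = μ s` and X-tightness `1 + μ (1 − s) = a`
  have e1 : 1 / (2 * s - 1) * s = s / (2 * s - 1) := by field_simp
  have e2 : 1 + 1 / (2 * s - 1) * (1 - s) = s / (2 * s - 1) := by field_simp; ring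
  have p1 : (a₀ - Real.log (1 + a₀)) * (1 + 1 / (2 * s - 1) * (1 - s))
      = (a₀ - Real.log (1 + a₀)) * (s / (2 * s - 1)) := by rw [e2]
  have p2 : (1 - s₀) * (1 / (2 * s - 1) * s) = (1 - s₀) * (s / (2 * s - 1)) := by rw [e1]
  linarith [hA, hD', p1, p2]

/-! ### §3  A rational certificate and the kernel floor -/

/-- `127/13 ≤ exp(57/25)` (`exp 2.28 = 9.7767…`, `127/13 = 9.7692…`): from `exp 1 > 2.7182818283` and
`exp(7/100) ≥ 1 + 7/100 + (7/100)²/2`, `exp(57/25) = (exp 1)² (exp(7/100))⁴`. [folklore] -/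
theorem exp_228_ge : (127 : ℝ) / 13 ≤ Real.exp (57 / 25) := by
  have e : (57 / 25 : ℝ) = (2 : ℕ) * 1 + (4 : ℕ) * (7 / 100) := by norm_num
  rw [e, Real.exp_add, Real.exp_nat_mul, Real.exp_nat_mul]
  have h1 := Real.exp_one_gt_d9
  have h2 := Real.quadratic_le_exp_of_nonneg (show (0 : ℝ) ≤ 7 / 100 by norm_num)
  have h1' : (2.7182818283 : ℝ) ^ 2 ≤ Real.exp 1 ^ 2 :=
    pow_le_pow_left₀ (by norm_num) h1.le 2
  have h2' : ((1 : ℝ) + 7 / 100 + (7 / 100) ^ 2 / 2) ^ 4 ≤ Real.exp (7 / 100) ^ 4 :=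
    pow_le_pow_left₀ (by norm_num) h2 4
  have h3 := mul_le_mul h1' h2' (by positivity) (by positivity)
  have h4 : (127 : ℝ) / 13 ≤ (2.7182818283 : ℝ) ^ 2 * ((1 : ℝ) + 7 / 100 + (7 / 100) ^ 2 / 2) ^ 4 := by
    norm_num
  linarith

/-- **The rational certificate** `(s₀, a₀) = (37/50, 77/50)` satisfies the coupling condition `(C)`:
`−37/50 − log(13/50) ≤ 77/50 − log(127/50)`, i.e. `log(127/13) ≤ 57/25`. [folklore] -/
theorem certC :
    -(37 / 50 : ℝ) - Real.log (1 - 37 / 50) ≤ 77 / 50 - Real.log (1 + 77 / 50) := by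
  have e1 : (1 : ℝ) - 37 / 50 = 13 / 50 := by norm_num
  have e2 : (1 : ℝ) + 77 / 50 = 127 / 50 := by norm_num
  rw [e1, e2]
  have h : Real.log (127 / 50) - Real.log (13 / 50) ≤ 57 / 25 := by
    rw [← Real.log_div (by norm_num) (by norm_num)]
    rw [show ((127 : ℝ) / 50) / (13 / 50) = 127 / 13 by norm_num]
    exact (Real.log_le_iff_le_exp (by norm_num)).2 exp_228_ge
  linarith

/-- Lower bound `0.2389883 ≤ log(127/100)` from six terms of the series of `−log(1 − x)` at
`x = 27/127` (`Real.abs_log_sub_add_sum_range_le`). [folklore] -/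
theorem log_127_ge : (0.2389883 : ℝ) ≤ Real.log (127 / 100) := by
  have hx : |(27 : ℝ) / 127| < 1 := by rw [abs_of_nonneg (by norm_num)]; norm_num
  have h := Real.abs_log_sub_add_sum_range_le hx 6
  rw [abs_of_nonneg (show (0 : ℝ) ≤ 27 / 127 by norm_num)] at h
  have e1 : (1 : ℝ) - 27 / 127 = (127 / 100)⁻¹ := by norm_num
  rw [e1, Real.log_inv] at h
  have h' := (abs_le.1 h).2
  simp only [Finset.sum_range_succ, Finset.sum_range_zero] at h'
  norm_num at h'
  linarith

/-- **Kernel floor of the certificate:** `1.0642 ≤ 2 log(127/50) − 4/5`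
(`= 2 log(1+a₀) − a₀ + s₀` at `(37/50, 77/50)`; exact value `1.06433`; the optimum over `(C)` is
`c⋆ = 1.0645958`, `e^{c⋆} = 2.89967`). [folklore] -/
theorem floor_gt : (1.0642 : ℝ) ≤ 2 * Real.log (127 / 50) - 4 / 5 := by
  have e : Real.log (127 / 50) = Real.log 2 + Real.log (127 / 100) := by
    rw [← Real.log_mul (by norm_num) (by norm_num)]; norm_num
  rw [e]
  have h1 := Real.log_two_gt_d9
  have h2 := log_127_ge
  linarith

/-- **The class floor, certified instance.**  Every finite mixture of one-step factors and donors
satisfying balance and the X-constraint has onset functional `≥ 1.0642 × (A-mass)`; in the cell's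
reading: no additive rotation-mixed level-1 z-perfect design on single-macro-block supports certifies
`Base θ` below `e^{1.0642} = 2.8985` (model floor `θ⋆ = 2.89967`; twin ceiling `θ_c = 2.90099`).
[cite: CoppersmithWinograd1990, §8] [cite: AlmanDuanVassilevskaWilliamsXuXuZhou2025, §3.4] -/
theorem class_floor {ι κ : Type*} (t : Finset ι) (u : Finset κ) (w a S b : ι → ℝ) (v s : κ → ℝ)
    (hw : ∀ i ∈ t, 0 ≤ w i) (ha : ∀ i ∈ t, 0 ≤ a i) (hS : ∀ i ∈ t, 0 ≤ S i)
    (hb0 : ∀ i ∈ t, 0 ≤ b i) (hbS : ∀ i ∈ t, b i ≤ S i)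
    (hv : ∀ k ∈ u, 0 ≤ v k) (hs1 : ∀ k ∈ u, s k ≤ 1)
    (hbal : ∑ i ∈ t, w i * a i = ∑ i ∈ t, w i * b i + ∑ k ∈ u, v k * s k)
    (hX : ∑ i ∈ t, w i * (1 + (S i - b i)) + ∑ k ∈ u, v k * (1 - s k) ≤ ∑ i ∈ t, w i * a i) :
    (1.0642 : ℝ) * ∑ i ∈ t, w i * a i ≤
      ∑ i ∈ t, w i * ((1 + a i) * Real.log (1 + a i) + (S i - b i) * Real.log ((S i - b i) / S i))
        + ∑ k ∈ u, v k * ((1 - s k) * Real.log (1 - s k)) := by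
  have hc := class_bound (s₀ := 37 / 50) (a₀ := 77 / 50) (by norm_num) (by norm_num) certC
    t u w a S b v s hw ha hS hb0 hbS hv hs1 hbal hX
  have e2 : (1 : ℝ) + 77 / 50 = 127 / 50 := by norm_num
  rw [e2] at hc
  have hf := floor_gt
  have hA : 0 ≤ ∑ i ∈ t, w i * a i :=
    Finset.sum_nonneg fun i hi => mul_nonneg (hw i hi) (ha i hi)
  nlinarith [mul_le_mul_of_nonneg_right hf hA]

end Summit.MatrixMultiplication.MatrixMultiplication.Theorems.SaturationLadderClassAtoms

end
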